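/-
Origin: expansion seat `planner-pub-hodgecm-pv01-g2-0`, handover v4 2026-08-18T05:29:04Z (doc-only) (`HOME/pub-hodgecm-pv01-g2/lean/Pv01g2/DenseDoubleCoset.lean`, md5 4bf3dde0, 97 lines);
landed by the gen-6 packager in gate run 23 REPLACES the earlier landed copy of `HodgeCM/PerL34/DenseDoubleCoset.lean` (stripped 1 #print/#check/#eval lines).
-/
/-
Copyright: publication cell pub-hodgecm (DAG-NODE PROVER #01, generation 2, planner-pub-hodgecm-pv01-g2-0).
Lean 4 / Mathlib only.  Intended final place `HodgeCM/PerL34/DenseDoubleCoset.lean`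
(module `HodgeCM.PerL34.DenseDoubleCoset`); no package imports, no import rewrites.

# The density step of N23c (PerL v5 Prop 3.6 Step 2, ll. 430–433) from real approximation AT INFINITY

The node-N23c shell `HodgeCM.PerL34.Annihilation.AnnihilationDatum` carries the PRINT field

  `dense : Dense {g : G | ∃ γ ∈ Γ, ∃ (t : TA) (hf : Gf), g = γ * ιA t * ιf hf}`

("`U(W)(L₀)·T(𝔸)·U(W)(𝔸_f)` is dense in `U(W)(𝔸)`", PerL ll. 431–433, argued there from real approximation
for `U(W)`: "given `(x_∞, x_f)`, real approximation … gives `γ ∈ U(W)(L₀)` close to `x_∞` in `U(W)(L₀ ⊗ ℝ)`, and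
`(γ, γ·γ⁻¹x_f)` lies in the set").  This file proves EXACTLY that two-line deduction, for an abstract topological
group `G` identified with a product `G∞ × Gf` (DEFINITIONAL: `U(W)(𝔸) = U(W)(L₀ ⊗ ℝ) × U(W)(𝔸_f)`), the finite part
embedded as the second factor, `1 ∈ T(𝔸)`, and the SINGLE analytic input

  `DenseRange (fun γ : Γ => (e γ).1)` — the image of `U(W)(L₀)` is dense in `U(W)(L₀ ⊗ ℝ)`,

where — CORRECTION (v2, adversarial objection adv1g6-O6) — PerL's `U(W)` is the unitary group of the hermitian
PLANE `W` over `L` (PerL ll. 314–315, 384; rank 2, a form of `U(1,1)`/`U(2)` over `L₀`), NOT the norm-one torus: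
the required input is real approximation for `U(W)` at ALL archimedean places simultaneously, i.e. that
`U(W)(L₀) → U(W)(L₀ ⊗ ℝ) = ∏_{w ∣ ∞} U(H_W^{w})`, `γ ↦ (γ^{w})_w`, has dense image (PerL cites [San, Cor. 3.5(iii)],
[PR, Thm. 7.7]).  In this package that statement is KERNEL for EVERY rank and every `σ`-hermitian invertible Gram
matrix (Cayley-transform proof run jointly over the infinite places, on Mathlib's weak approximation), by name
`HodgeCM.Literature.RealApproximation_UH_holds` / `HodgeCM.Literature.RealApproximation.denseRange_archEmb` (pv06-g2,
`HodgeCM/Literature/RealApproximationUnitary.lean`) — the cell's ONE designated discharge (owner decision, STATUS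
05:27:46Z / 05:28:20Z); proved independently by this seat as a standby the packager lands only if that file slips
(`HodgeCM.PerL34.RealApproximation.denseRange_unitaryGroup_places`, `RealApproximationCM.lean`) — up to the
DEFINITIONAL identification of `U(W)(L₀ ⊗ ℝ)` with that product.  So the field `dense` is PRINT no longer: it is
DEFINITIONAL (product structure) + KERNEL (real approximation at infinity, rank 2).  v1 of this docstring named
`RealApproximation_U1_holds` (the torus) as the input — WRONG AS A LABEL; the lemmas below are unchanged and
rank-agnostic.

* `dense_fst_preimage`            : `{g | (e g).1 ∈ closure-dense set}` is dense (open projection);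
* `dense_cosetSet_of_denseRange`  : the field `dense` in its verbatim shape.

NOTHING is cited or posited; no placeholders; standard axioms.
-/
import Mathlib.Topology.Algebra.Group.Basic
import Mathlib.Topology.Constructions

/-! PORT of `HodgeCM/PerL34/DenseDoubleCoset.lean` (HodgeCMPerL run 81) — verbatim mechanical port; provenance in the PORT header line. -/

set_option autoImplicit false

namespace HodgeCM
namespace PerL34
namespace Annihilation

variable {G Ginf Gf TA : Type*} [Group G] [TopologicalSpace G] [Group Ginf] [TopologicalSpace Ginf]
  [Group Gf] [TopologicalSpace Gf]

omit [Group G] [Group Ginf] [Group Gf] in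
/-- If `e : G → Ginf × Gf` is an open map and `R ⊆ Ginf` is dense, then `{g | (e g).1 ∈ R}` is dense in `G`. -/
theorem dense_fst_preimage (e : G → Ginf × Gf) (he : IsOpenMap e) {R : Set Ginf} (hR : Dense R) :
    Dense {g : G | (e g).1 ∈ R} := by
  have h : Dense ((Prod.fst ∘ e) ⁻¹' R) := hR.preimage (isOpenMap_fst.comp he)
  simpa [Set.preimage, Function.comp] using h

/-- **PerL v5 ll. 430–433 (N23c, density of `U(W)(L₀)·T(𝔸)·U(W)(𝔸_f)` in `U(W)(𝔸)`) from real approximation at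
infinity.**  Dictionary: `e : G ≃* Ginf × Gf` an open multiplicative bijection (`U(W)(𝔸) = U(W)(L₀⊗ℝ) × U(W)(𝔸_f)`
as topological groups — openness is what a homeomorphism gives), `ιf` the inclusion of the second factor
(`e (ιf h) = (1, h)`), `t₀ ∈ T(𝔸)` with `ιA t₀ = 1`; analytic input: the first components of `e(Γ)` are dense in
`Ginf` (real approximation for `U(W)` over `L₀` at the archimedean places).  Conclusion: the verbatim `dense` field
of `AnnihilationDatum`.  Proof = PerL's: for `g` with `(e g).1 = (e γ).1` put `hf := ((e γ).2)⁻¹ * (e g).2`; then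
`e (γ * ιA t₀ * ιf hf) = e g`. -/
theorem dense_cosetSet_of_denseRange (e : G ≃* Ginf × Gf) (he : IsOpenMap e) (Γ : Subgroup G)
    (ιA : TA → G) (t₀ : TA) (ht₀ : ιA t₀ = 1) (ιf : Gf →* G) (hιf : ∀ h : Gf, e (ιf h) = (1, h))
    (hΓ : DenseRange (fun γ : Γ => (e (γ : G)).1)) :
    Dense {g : G | ∃ γ ∈ Γ, ∃ (t : TA) (hf : Gf), g = γ * ιA t * ιf hf} := by
  refine (dense_fst_preimage e he hΓ).mono ?_
  rintro g ⟨γ, hγ⟩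
  refine ⟨γ, γ.2, t₀, ((e (γ : G)).2)⁻¹ * (e g).2, ?_⟩
  apply e.injective
  rw [map_mul, map_mul, ht₀, map_one, mul_one, hιf, Prod.ext_iff]
  refine ⟨?_, ?_⟩
  · simp [hγ]
  · simp

/-- The same with the analytic input phrased as density of a SUBSET of `Ginf` containing the first components of
`e(Γ)` — the shape in which real approximation for `U(W)` at all archimedean places delivers it
(`RealApproximation_UH_holds` / `denseRange_archEmb` — see the module docstring) after the DEFINITIONAL
identification of `Ginf = U(W)(L₀ ⊗ ℝ)` with `∏_{w ∣ ∞} U(H_W^{w})`. -/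
theorem dense_cosetSet_of_dense_image (e : G ≃* Ginf × Gf) (he : IsOpenMap e) (Γ : Subgroup G)
    (ιA : TA → G) (t₀ : TA) (ht₀ : ιA t₀ = 1) (ιf : Gf →* G) (hιf : ∀ h : Gf, e (ιf h) = (1, h))
    (hΓ : Dense ((fun γ : G => (e γ).1) '' (Γ : Set G))) :
    Dense {g : G | ∃ γ ∈ Γ, ∃ (t : TA) (hf : Gf), g = γ * ιA t * ιf hf} := by
  refine dense_cosetSet_of_denseRange e he Γ ιA t₀ ht₀ ιf hιf ?_
  rw [DenseRange]
  convert hΓ using 1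
  ext x
  simp

end Annihilation
end PerL34
end HodgeCM

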